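import Mathlib.Analysis.ODE.Gronwall
import Literature.MathematicalPhysics.KineticTheory.HardSphereEulerPrimitiveForm
import Literature.MathematicalPhysics.KineticTheory.HardSphereEulerLocalTheoryProofs
import Literature.Analysis.FunctionSpaces.TorusCalculusProofs
import Literature.Analysis.FunctionSpaces.TorusSpaceTime
import HarnessLib

/-!
# Uniqueness of classical solutions of the hard-sphere compressible Euler system on `𝕋³`
# (relative-energy method; Dafermos 2005, Thm 5.2.1, classical-vs-classical case)

MathematicalPhysics/KineticTheory proof file (theorems only; no definitions, no named facts),
second half of the UNIQUENESS layer of the local theory of classical solutions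
`IsHardSphereEulerSolution σ T ρ u θ` (`HardSphereEuler.lean`), sequel of
`HardSphereEulerPrimitiveForm.lean` (primitive equations and the pointwise relative-energy
balance `∂ₜe + Σᵢ ∂ᵢΦᵢ = R`). Source: C. M. Dafermos, *Hyperbolic Conservation Laws in Continuum
Physics*, 2nd ed. (2005), Ch. V, §5.2, Thm 5.2.1 (held text, p. 126: a classical solution `U` of a
system of conservation laws endowed with a convex entropy, with values in a compact subset of the
state domain and bounded gradient on `[0, T)`, is `L²`-stable —
`‖U(t) - Ū(t)‖_{L²} ≤ a e^{bt} ‖U₀ - Ū₀‖_{L²}` — within the class of admissible weak solutions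
`Ū` with values in a compact set; in particular it is unique there). Only the special case needed
by the tree is proved: both solutions CLASSICAL (jointly `C^∞`), periodic box `𝕋³`, the `5 × 5`
hard-sphere Euler system with pressure `p = ρ θ ζ(ρ)`; the relative entropy of print is replaced
by the equivalent symmetrised quadratic energy `e = ½ (A α² + ρ |w|² + B β²)` of the difference
(`A = θ(ζ + ρζ')(ρ)/ρ`, `B = 3ρ/(2θ)`: the Friedrichs symmetriser), whose balance law is the
pointwise identity of the prequel; Grönwall's inequality then forces `e ≡ 0` from `e(0, ·) = 0`.

* `HsEulerCalc.torus_energy_eq_zero_of_balance` — the abstract Grönwall shell on `[0, T) × 𝕋³`: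
  jointly smooth `e ≥ 0`, `Φᵢ` with `e(0, ·) = 0` and `∂ₜe + Σᵢ ∂ᵢΦᵢ ≤ C e` on every compact
  time slab force `e ≡ 0` (divergence theorem on `𝕋³`, differentiation under `∫`, one-sided
  Grönwall `le_gronwallBound_of_liminf_deriv_right_le`, "continuous, nonnegative, integral zero
  ⟹ zero"), with the compactness tools (uniform bounds of jointly smooth fields on compact slabs)
  and the bilinear absorption `|Σ cₖ aₖ bₖ| ≤ K Σ (aₖ² + bₖ²)`;
* `IsHardSphereEulerSolution.relativeEnergy_remainder_le` / `.relativeEnergy_coercive` — the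
  remainder `R` of the balance is `≤ C (α² + β² + |w|²)` and the energy is `≥ m (α² + β² + |w|²)`,
  `m > 0`, on compact time slabs (coefficients are jointly smooth, hence bounded; `ζ`, `ζ + id·ζ'`
  Lipschitz on the density range; hyperbolicity `ζ + ρζ' > 0` makes `A > 0`);
* `IsHardSphereEulerSolution.unique_of_smooth_eos` — two classical solutions on `[0, T) × 𝕋³`
  whose pressure fields are `ρ θ ζ(ρ)`, `ρ' θ' ζ(ρ')` for ONE `ζ` smooth on an open `J ⊇ [a, b]`
  with `ζ + id·ζ' > 0` on `[a, b]`, densities valued in `[a, b]`, equal data at `t = 0`, coincide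
  on `[0, T)`;
* `hsEuler_uniqueness_smallPacking` — the hard-sphere specialisation under the equation-of-state
  hypothesis of `HardSphereEulerLocalTheory.lean` (`hsExcessFreeEnergy = F` on `[0, η₀)`, `F`
  analytic on `(-η₀, η₀)`): there is `η₁ > 0` (from `Z + ηZ' → 1` as `η → 0`, `Z = 1 + ηF'`) such
  that for every `σ > 0` two classical solutions with packing `ρσ³, ρ'σ³ ≤ η₁` and equal data
  coincide — literally hypothesis (3) `huniq` of
  `hsEuler_continuousDependence_of_localTheory` (`HardSphereEulerContinuousDependenceProofs.lean`).

Ported from the summit-side files `Summits/AtomisticToContinuum/HydrodynamicLimit/Theorems/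
ImplosionDichotomyPolynomialCompressionUniqueness{Energy,SmoothEos,}.lean` (which Literature may
not import, CONVENTIONS §2); generic helpers keep their short names inside the sub-namespace
`HsEulerCalc`, the solution-level theorems get dot-names under `IsHardSphereEulerSolution`.

## Mathlib / tree search

Mathlib: `le_gronwallBound_of_liminf_deriv_right_le`, `gronwallBound_ε0_δ0`,
`Convex.norm_image_sub_le_of_norm_hasDerivWithin_le`, `MeasureTheory.integral_eq_zero_iff_of_nonneg`,
`Continuous.ae_eq_iff_eq`. Tree: `Torus.IsSmoothSpaceTimeOn.hasDerivWithinAt_integral`,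
`Torus.integral_partialDeriv_eq_zero_holds`, `Torus.IsSmoothSpaceTimeOn.exists_norm_le_of_isCompact`,
`hsCompressibility_eq` (`HardSphereEulerLocalTheoryProofs.lean`). No classical-uniqueness theorem
for the compressible Euler system existed in Literature (`lean search 'unique'` over
`Literature/Analysis/FluidPDE`, `Literature/MathematicalPhysics/KineticTheory`): the measure-valued
weak–strong uniqueness `brezinaFeireisl2018_thm_3_3_holds` (`MVWeakStrongUniquenessProofs.lean`)
needs the full Gibbs thermodynamics of the equation of state and a Young-measure solution, not the
bare pressure hypothesis used by the hard-sphere local theory.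

## References

* C. M. Dafermos, *Hyperbolic Conservation Laws in Continuum Physics*, 2nd ed., Grundlehren 325,
  Springer 2005: Ch. V, §5.2, Thm 5.2.1; §5.1 (symmetriser / convex entropy). [`Dafermos2005`]
* A. Majda, *Compressible Fluid Flow and Systems of Conservation Laws in Several Space
  Variables*, Appl. Math. Sci. 53, Springer 1984: Ch. 2, §2.1, proof of Thm 2.1 (uniqueness by
  the `L²` energy estimate). [`Majda1984`]
* T. Kato, *The Cauchy problem for quasi-linear symmetric hyperbolic systems*, Arch. Rational
  Mech. Anal. 58 (1975) 181–205: Thm II (uniqueness clause). [`Kato1975`]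
-/

noncomputable section

open Set Filter MeasureTheory
open _root_.Topology
open scoped ContDiff

namespace Literature.MathematicalPhysics.KineticTheory

open Literature.Analysis.FunctionSpaces

namespace HsEulerCalc

/-! ### Scalar one-sided Grönwall: `φ' ≤ K φ`, `φ(0) = 0`, `φ ≥ 0` force `φ = 0` -/

/-- One-sided Grönwall uniqueness on `[0, t₁]`: a function continuous on `[0, t₁]`, with right
derivative `φ' s ≤ K φ s` at every `s ∈ [0, t₁)`, `φ 0 = 0` and `φ ≥ 0`, vanishes on `[0, t₁]`
(Mathlib `le_gronwallBound_of_liminf_deriv_right_le` with `δ = ε = 0`). [folklore] -/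
theorem eq_zero_of_deriv_right_le_mul_self {φ φ' : ℝ → ℝ} {K t₁ : ℝ}
    (hcont : ContinuousOn φ (Icc 0 t₁))
    (hderiv : ∀ s ∈ Ico 0 t₁, HasDerivWithinAt φ (φ' s) (Ici s) s)
    (h0 : φ 0 = 0) (hnonneg : ∀ s ∈ Icc 0 t₁, 0 ≤ φ s)
    (hbound : ∀ s ∈ Ico 0 t₁, φ' s ≤ K * φ s) : ∀ s ∈ Icc 0 t₁, φ s = 0 := by
  have hle := le_gronwallBound_of_liminf_deriv_right_le (f := φ) (f' := φ') (δ := 0) (K := K)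
    (ε := 0) (a := 0) (b := t₁) hcont (fun s hs r hr => ?_) h0.le (fun s hs => by
      simpa using hbound s hs)
  · intro s hs
    have h := hle s hs
    rw [gronwallBound_ε0_δ0] at h
    exact le_antisymm h (hnonneg s hs)
  · refine ((hderiv s hs).liminf_right_slope_le hr).mono fun z hz => ?_
    rwa [slope_def_field, div_eq_inv_mul] at hz

/-! ### Uniform bounds of jointly smooth fields on compact time slabs -/

/-- A jointly smooth scalar field on `[0, T) × 𝕋³` is bounded in absolute value on
`[0, t₁] × 𝕋³` for every `t₁ < T`. [folklore] -/
theorem exists_abs_le_of_isSmoothSpaceTimeOn {T t₁ : ℝ} {f : ℝ → T3 → ℝ}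
    (hf : Torus.IsSmoothSpaceTimeOn (Ico 0 T) f) (ht₁ : t₁ < T) :
    ∃ K, 0 ≤ K ∧ ∀ t ∈ Icc 0 t₁, ∀ x, |f t x| ≤ K := by
  obtain ⟨K, hK⟩ := hf.exists_norm_le_of_isCompact isCompact_Icc (Icc_subset_Ico_right ht₁)
  refine ⟨max K 0, le_max_right _ _, fun t ht x => ?_⟩
  rw [← Real.norm_eq_abs]
  exact (hK t ht x).trans (le_max_left _ _)

/-- Finitely many jointly smooth scalar fields on `[0, T) × 𝕋³` admit a common bound on
`[0, t₁] × 𝕋³`, `t₁ < T`. [folklore] -/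
theorem exists_forall_abs_le_of_isSmoothSpaceTimeOn {ι : Type*} [Fintype ι] {T t₁ : ℝ}
    {f : ι → ℝ → T3 → ℝ} (hf : ∀ k, Torus.IsSmoothSpaceTimeOn (Ico 0 T) (f k)) (ht₁ : t₁ < T) :
    ∃ K, 0 ≤ K ∧ ∀ k, ∀ t ∈ Icc 0 t₁, ∀ x, |f k t x| ≤ K := by
  choose K hK0 hK using fun k => exists_abs_le_of_isSmoothSpaceTimeOn (hf k) ht₁
  refine ⟨∑ k, K k, Finset.sum_nonneg fun k _ => hK0 k, fun k t ht x => ?_⟩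
  exact (hK k t ht x).trans (Finset.single_le_sum (fun j _ => hK0 j) (Finset.mem_univ k))

/-- A positive jointly smooth scalar field on `[0, T) × 𝕋³` is bounded below by a positive
constant on `[0, t₁] × 𝕋³`, `t₁ < T` (its inverse is jointly smooth, hence bounded). [folklore] -/
theorem exists_pos_le_of_isSmoothSpaceTimeOn {T t₁ : ℝ} {f : ℝ → T3 → ℝ}
    (hf : Torus.IsSmoothSpaceTimeOn (Ico 0 T) f) (hpos : ∀ t ∈ Ico 0 T, ∀ x, 0 < f t x)
    (ht₁ : t₁ < T) : ∃ c, 0 < c ∧ ∀ t ∈ Icc 0 t₁, ∀ x, c ≤ f t x := by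
  have hinv : Torus.IsSmoothSpaceTimeOn (Ico 0 T) (fun t x => (f t x)⁻¹) := by
    refine ContDiffOn.inv hf ?_
    rintro ⟨t, y⟩ hp
    exact (hpos t (mem_prod.1 hp).1 _).ne'
  obtain ⟨K, hK0, hK⟩ := exists_abs_le_of_isSmoothSpaceTimeOn hinv ht₁
  refine ⟨(K + 1)⁻¹, by positivity, fun t ht x => ?_⟩
  have hft : 0 < f t x := hpos t ⟨ht.1, ht.2.trans_lt ht₁⟩ x
  have h1 : (f t x)⁻¹ ≤ K + 1 := ((le_abs_self _).trans (hK t ht x)).trans (by linarith)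
  rw [inv_le_comm₀ (by positivity) hft]
  exact h1

/-! ### Bilinear absorption -/

/-- `|Σₖ cₖ aₖ bₖ| ≤ K Σₖ (aₖ² + bₖ²)` when `|cₖ| ≤ K` (`2|ab| ≤ a² + b²`). [folklore] -/
theorem abs_sum_mul_mul_le {ι : Type*} (s : Finset ι) {c a b : ι → ℝ} {K : ℝ}
    (hc : ∀ k ∈ s, |c k| ≤ K) :
    |∑ k ∈ s, c k * a k * b k| ≤ K * ∑ k ∈ s, (a k ^ 2 + b k ^ 2) := by
  rw [Finset.mul_sum]
  refine (Finset.abs_sum_le_sum_abs _ _).trans (Finset.sum_le_sum fun k hk => ?_)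
  rw [abs_mul, abs_mul]
  have hK : 0 ≤ K := (abs_nonneg _).trans (hc k hk)
  have hab : |a k| * |b k| ≤ a k ^ 2 + b k ^ 2 := by
    nlinarith [sq_nonneg (|a k| - |b k|), sq_abs (a k), sq_abs (b k), abs_nonneg (a k),
      abs_nonneg (b k)]
  calc |c k| * |a k| * |b k| = |c k| * (|a k| * |b k|) := by ring
    _ ≤ K * (a k ^ 2 + b k ^ 2) :=
      mul_le_mul (hc k hk) hab (mul_nonneg (abs_nonneg _) (abs_nonneg _)) hK

/-! ### Continuous nonnegative functions on `𝕋³` with zero integral vanish -/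

/-- A continuous nonnegative function on `𝕋³` with integral zero vanishes identically (the Haar
probability measure of `𝕋³` charges open sets). [folklore] -/
theorem eq_zero_of_integral_eq_zero_of_nonneg {g : T3 → ℝ} (hg : Continuous g)
    (hnonneg : ∀ x, 0 ≤ g x) (hint : ∫ x, g x = 0) : ∀ x, g x = 0 := by
  have hae : g =ᵐ[volume] 0 :=
    (integral_eq_zero_iff_of_nonneg (fun x => hnonneg x) hg.integrable_unitAddTorus).1 hint
  have heq : g = 0 := (Continuous.ae_eq_iff_eq volume hg continuous_const).1 hae
  exact fun x => congrFun heq x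

/-! ### The Grönwall shell on `[0, T) × 𝕋³` -/

/-- **Energy method on the torus, abstract shell.** Let `e` (energy density) and `Φ₀, Φ₁, Φ₂`
(fluxes) be jointly smooth scalar fields on `[0, T) × 𝕋³` with `e ≥ 0`, `e(0, ·) = 0`, and the
pointwise balance `∂ₜe + Σᵢ ∂ᵢΦᵢ ≤ C e` on `[0, t₁] × 𝕋³` for every `t₁ < T` (a constant `C`
depending on `t₁`; `∂ₜ` one-sided within `[0, T)`). Then `e ≡ 0` on `[0, T) × 𝕋³`: the total
energy `E(t) = ∫ e(t, x) dx` has one-sided derivative `∫ ∂ₜe = ∫ (∂ₜe + Σᵢ∂ᵢΦᵢ) ≤ C E`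
(divergence theorem on `𝕋³`, differentiation under `∫`), `E(0) = 0`, `E ≥ 0`, so `E ≡ 0` by
Grönwall, and a continuous nonnegative slice with zero integral vanishes. [folklore] -/
theorem torus_energy_eq_zero_of_balance :
    ∀ {T : ℝ} {e : ℝ → T3 → ℝ} {Φ : Fin 3 → ℝ → T3 → ℝ},
      Torus.IsSmoothSpaceTimeOn (Ico 0 T) e → (∀ i, Torus.IsSmoothSpaceTimeOn (Ico 0 T) (Φ i)) →
      (∀ t ∈ Ico 0 T, ∀ x, 0 ≤ e t x) → (∀ x, e 0 x = 0) →
      (∀ t₁ ∈ Ico 0 T, ∃ C : ℝ, ∀ t ∈ Icc 0 t₁, ∀ x,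
        Torus.timeDerivWithin (Ico 0 T) e t x + ∑ i, Torus.partialDeriv i (Φ i t) x ≤ C * e t x) →
      ∀ t ∈ Ico 0 T, ∀ x, e t x = 0 := by
  intro T e Φ he hΦ hnonneg hinit hbal t₁ ht₁
  have hT : (0 : ℝ) < T := ht₁.1.trans_lt ht₁.2
  have hU : UniqueDiffOn ℝ (Ico (0 : ℝ) T) := uniqueDiffOn_Ico 0 T
  obtain ⟨C, hC⟩ := hbal t₁ ht₁
  -- the total energy and its one-sided derivative
  set E : ℝ → ℝ := fun t => ∫ x, e t x with hE
  have hderiv : ∀ s ∈ Ico 0 T, HasDerivWithinAt E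
      (∫ x, Torus.timeDerivWithin (Ico 0 T) e s x) (Ico 0 T) s :=
    fun s hs => he.hasDerivWithinAt_integral (convex_Ico 0 T) hs
  -- `∫ ∂ₜe = ∫ (∂ₜe + div Φ) ≤ C E` on `[0, t₁]`
  have hflux : ∀ s ∈ Ico 0 T, ∫ x, ∑ i, Torus.partialDeriv i (Φ i s) x = 0 := by
    intro s hs
    rw [integral_finsetSum _ fun i _ => (((hΦ i).isSmooth_slice hs).partialDeriv i).integrable]
    exact Finset.sum_eq_zero fun i _ =>
      Torus.integral_partialDeriv_eq_zero_holds ((hΦ i).isSmooth_slice hs) i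
  have hle : ∀ s ∈ Ico 0 t₁, ∫ x, Torus.timeDerivWithin (Ico 0 T) e s x ≤ C * E s := by
    intro s hs
    have hsT : s ∈ Ico 0 T := ⟨hs.1, hs.2.trans ht₁.2⟩
    have hi1 : Integrable (Torus.timeDerivWithin (Ico 0 T) e s) volume :=
      (he.isSmooth_timeDerivWithin hU hsT).integrable
    have hi2 : Integrable (fun x => ∑ i, Torus.partialDeriv i (Φ i s) x) volume :=
      integrable_finsetSum _ fun i _ => (((hΦ i).isSmooth_slice hsT).partialDeriv i).integrable
    have hi3 : Integrable (fun x => C * e s x) volume := ((he.isSmooth_slice hsT).integrable).const_mul C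
    calc ∫ x, Torus.timeDerivWithin (Ico 0 T) e s x
        = ∫ x, (Torus.timeDerivWithin (Ico 0 T) e s x + ∑ i, Torus.partialDeriv i (Φ i s) x) := by
          rw [integral_add hi1 hi2, hflux s hsT, add_zero]
      _ ≤ ∫ x, C * e s x := integral_mono (hi1.add hi2) hi3 fun x => hC s (Ico_subset_Icc_self hs) x
      _ = C * E s := integral_const_mul C _
  -- Grönwall on `[0, t₁]`
  have hcont : ContinuousOn E (Icc 0 t₁) := fun s hs =>
    ((hderiv s ⟨hs.1, hs.2.trans_lt ht₁.2⟩).continuousWithinAt).mono (Icc_subset_Ico_right ht₁.2)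
  have hright : ∀ s ∈ Ico 0 t₁,
      HasDerivWithinAt E (∫ x, Torus.timeDerivWithin (Ico 0 T) e s x) (Ici s) s := by
    intro s hs
    have hsT : s ∈ Ico 0 T := ⟨hs.1, hs.2.trans ht₁.2⟩
    exact (hderiv s hsT).mono_of_mem_nhdsWithin
      (Filter.mem_of_superset (Ico_mem_nhdsGE hsT.2) (Ico_subset_Ico_left hsT.1))
  have hE0 : E 0 = 0 := by
    simp only [hE]
    exact integral_eq_zero_of_ae (Eventually.of_forall hinit)
  have hEnonneg : ∀ s ∈ Icc 0 t₁, 0 ≤ E s := fun s hs =>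
    integral_nonneg fun x => hnonneg s ⟨hs.1, hs.2.trans_lt ht₁.2⟩ x
  have hEzero := eq_zero_of_deriv_right_le_mul_self hcont hright hE0 hEnonneg hle t₁
    (right_mem_Icc.2 ht₁.1)
  -- a continuous nonnegative slice with zero integral vanishes
  exact eq_zero_of_integral_eq_zero_of_nonneg (he.isSmooth_slice ht₁).continuous
    (fun x => hnonneg t₁ ht₁ x) hEzero


/-! ### Real-variable tools -/

/-- A function smooth on an open set `J` is Lipschitz on every compact interval `[a, b] ⊆ J`
(mean value theorem with the bound of the continuous derivative on `[a, b]`). [folklore] -/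
theorem exists_abs_sub_le_mul_of_contDiffOn {ζ : ℝ → ℝ} {J : Set ℝ} (hJ : IsOpen J)
    (hζ : ContDiffOn ℝ ∞ ζ J) {a b : ℝ} (hab : Icc a b ⊆ J) :
    ∃ L, 0 ≤ L ∧ ∀ r ∈ Icc a b, ∀ r' ∈ Icc a b, |ζ r - ζ r'| ≤ L * |r - r'| := by
  have hcont : ContinuousOn (deriv ζ) (Icc a b) :=
    ((hζ.deriv_of_isOpen (m := ∞) hJ le_rfl).continuousOn).mono hab
  obtain ⟨L, hL⟩ := isCompact_Icc.exists_bound_of_continuousOn hcont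
  refine ⟨max L 0, le_max_right _ _, fun r hr r' hr' => ?_⟩
  have hd : ∀ s ∈ Icc a b, HasDerivWithinAt ζ (deriv ζ s) (Icc a b) s := fun s hs =>
    (((hζ.differentiableOn (by simp)).differentiableAt (hJ.mem_nhds (hab hs))).hasDerivAt).hasDerivWithinAt
  have h := (convex_Icc a b).norm_image_sub_le_of_norm_hasDerivWithin_le hd
    (fun s hs => (hL s hs).trans (le_max_left L 0)) hr' hr
  simpa only [Real.norm_eq_abs] using h

/-- Chaining `R ≤ C q`, `m q ≤ E` (`q ≥ 0`, `m > 0`) into `R ≤ (max C 0 / m) E`. [folklore] -/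
theorem le_max_div_mul_of_le {R C q m E : ℝ} (h1 : R ≤ C * q) (h2 : m * q ≤ E) (hq : 0 ≤ q)
    (hm : 0 < m) : R ≤ max C 0 / m * E := by
  have h3 : R ≤ max C 0 * q := h1.trans (mul_le_mul_of_nonneg_right (le_max_left _ _) hq)
  have h4 : max C 0 * q = max C 0 / m * (m * q) := by
    field_simp
  rw [h4] at h3
  exact h3.trans (mul_le_mul_of_nonneg_left h2 (div_nonneg (le_max_right _ _) hm.le))

/-- **Absorption of the bilinear remainder** (pure algebra): a bilinear form in the small
quantities `α, β, wⱼ, δγ, δζ` with coefficients bounded by `K`, where `|δζ| ≤ L_ζ |α|` and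
`|δγ| ≤ L_γ |α|`, is bounded by `K (10 + 3L_γ² + 4L_ζ²)(α² + β² + Σⱼwⱼ²)`. [folklore] -/
theorem remainder_alg_le {c1 c2 c8 K al be dz dg Lz Lg : ℝ} {c3 c5 c6 c7 w : Fin 3 → ℝ}
    {c4 : Fin 3 → Fin 3 → ℝ} (h1 : |c1| ≤ K) (h2 : |c2| ≤ K) (h3 : ∀ j, |c3 j| ≤ K)
    (h4 : ∀ i j, |c4 i j| ≤ K) (h5 : ∀ j, |c5 j| ≤ K) (h6 : ∀ j, |c6 j| ≤ K) (h7 : ∀ j, |c7 j| ≤ K)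
    (h8 : |c8| ≤ K) (hz : |dz| ≤ Lz * |al|) (hg : |dg| ≤ Lg * |al|) :
    c1 * al ^ 2 + c2 * be ^ 2 + ∑ j, c3 j * al * w j + ∑ i, ∑ j, c4 i j * w i * w j +
      ∑ j, c5 j * be * w j + ∑ j, c6 j * dg * w j + ∑ j, c7 j * dz * w j + c8 * be * dz ≤
      K * (10 + 3 * Lg ^ 2 + 4 * Lz ^ 2) * (al ^ 2 + be ^ 2 + ∑ j, w j ^ 2) := by
  have hK : 0 ≤ K := (abs_nonneg _).trans h1
  have e1 : c1 * al ^ 2 ≤ K * al ^ 2 :=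
    (le_abs_self _).trans (by rw [abs_mul, abs_pow, sq_abs]; exact mul_le_mul_of_nonneg_right h1 (sq_nonneg _))
  have e2 : c2 * be ^ 2 ≤ K * be ^ 2 :=
    (le_abs_self _).trans (by rw [abs_mul, abs_pow, sq_abs]; exact mul_le_mul_of_nonneg_right h2 (sq_nonneg _))
  have e3 : ∑ j, c3 j * al * w j ≤ K * ∑ j, (al ^ 2 + w j ^ 2) :=
    (le_abs_self _).trans (abs_sum_mul_mul_le _ fun k _ => h3 k)
  have e4 : ∑ i, ∑ j, c4 i j * w i * w j ≤ ∑ i, K * ∑ j, (w i ^ 2 + w j ^ 2) :=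
    Finset.sum_le_sum fun i _ => (le_abs_self _).trans (abs_sum_mul_mul_le _ fun k _ => h4 i k)
  have e5 : ∑ j, c5 j * be * w j ≤ K * ∑ j, (be ^ 2 + w j ^ 2) :=
    (le_abs_self _).trans (abs_sum_mul_mul_le _ fun k _ => h5 k)
  have e6 : ∑ j, c6 j * dg * w j ≤ K * ∑ j, (dg ^ 2 + w j ^ 2) :=
    (le_abs_self _).trans (abs_sum_mul_mul_le _ fun k _ => h6 k)
  have e7 : ∑ j, c7 j * dz * w j ≤ K * ∑ j, (dz ^ 2 + w j ^ 2) :=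
    (le_abs_self _).trans (abs_sum_mul_mul_le _ fun k _ => h7 k)
  have e8 : c8 * be * dz ≤ K * (be ^ 2 + dz ^ 2) := by
    have h := abs_sum_mul_mul_le {(0 : Fin 3)} (c := fun _ => c8) (a := fun _ => be) (b := fun _ => dz)
      (K := K) fun _ _ => h8
    simp only [Finset.sum_singleton] at h
    exact (le_abs_self _).trans h
  have hdg2 : dg ^ 2 ≤ Lg ^ 2 * al ^ 2 := by
    have h := pow_le_pow_left₀ (abs_nonneg _) hg 2
    rw [sq_abs, mul_pow, sq_abs] at h
    exact h
  have hdz2 : dz ^ 2 ≤ Lz ^ 2 * al ^ 2 := by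
    have h := pow_le_pow_left₀ (abs_nonneg _) hz 2
    rw [sq_abs, mul_pow, sq_abs] at h
    exact h
  have hKdg : K * dg ^ 2 ≤ K * (Lg ^ 2 * al ^ 2) := mul_le_mul_of_nonneg_left hdg2 hK
  have hKdz : K * dz ^ 2 ≤ K * (Lz ^ 2 * al ^ 2) := mul_le_mul_of_nonneg_left hdz2 hK
  simp only [Fin.sum_univ_three] at e3 e4 e5 e6 e7 ⊢
  nlinarith [mul_nonneg hK (sq_nonneg al), mul_nonneg hK (sq_nonneg be), mul_nonneg hK (sq_nonneg (w 0)),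
    mul_nonneg hK (sq_nonneg (w 1)), mul_nonneg hK (sq_nonneg (w 2)),
    mul_nonneg hK (mul_nonneg (sq_nonneg Lg) (sq_nonneg al)),
    mul_nonneg hK (mul_nonneg (sq_nonneg Lz) (sq_nonneg al))]

/-- **Coercivity of the relative energy** (pure algebra): with `A ≥ a₀ > 0`, `ρ ≥ ρ₀ > 0`,
`B ≥ b₀ > 0`, `½(A α² + ρ n + B β²) ≥ (min(a₀, ρ₀, b₀)/2)(α² + β² + n)` for `n ≥ 0`. [folklore] -/
theorem energy_alg_ge {A r B a0 r0 b0 al be n : ℝ} (ha : a0 ≤ A) (hr : r0 ≤ r) (hb : b0 ≤ B)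
    (hn : 0 ≤ n) :
    min (min a0 r0) b0 / 2 * (al ^ 2 + be ^ 2 + n) ≤ 1 / 2 * (A * al ^ 2 + r * n + B * be ^ 2) := by
  have h1 : min (min a0 r0) b0 ≤ a0 := (min_le_left _ _).trans (min_le_left _ _)
  have h2 : min (min a0 r0) b0 ≤ r0 := (min_le_left _ _).trans (min_le_right _ _)
  have h3 : min (min a0 r0) b0 ≤ b0 := min_le_right _ _
  nlinarith [mul_le_mul_of_nonneg_right (h1.trans ha) (sq_nonneg al),
    mul_le_mul_of_nonneg_right (h2.trans hr) hn, mul_le_mul_of_nonneg_right (h3.trans hb) (sq_nonneg be)]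

/-- **Vanishing of the relative energy forces equality** (pure algebra): with `A, ρ, B > 0`,
`½(A α² + ρ ‖w‖² + B β²) = 0` gives `α = 0`, `w = 0`, `β = 0`. [folklore] -/
theorem eq_of_energy_eq_zero {A r B al be : ℝ} {w : V3} (hA : 0 < A) (hr : 0 < r) (hB : 0 < B)
    (h : 1 / 2 * (A * al ^ 2 + r * ‖w‖ ^ 2 + B * be ^ 2) = 0) : al = 0 ∧ w = 0 ∧ be = 0 := by
  have h1 : 0 ≤ A * al ^ 2 := mul_nonneg hA.le (sq_nonneg _)
  have h2 : 0 ≤ r * ‖w‖ ^ 2 := mul_nonneg hr.le (sq_nonneg _)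
  have h3 : 0 ≤ B * be ^ 2 := mul_nonneg hB.le (sq_nonneg _)
  have hal : A * al ^ 2 = 0 := by linarith
  have hw : r * ‖w‖ ^ 2 = 0 := by linarith
  have hbe : B * be ^ 2 = 0 := by linarith
  refine ⟨?_, ?_, ?_⟩
  · simpa [hA.ne'] using hal
  · simpa [hr.ne'] using hw
  · simpa [hB.ne'] using hbe

end HsEulerCalc

open HsEulerCalc

/-! ### The remainder and the energy along two solutions -/

section Solutions

variable {σ T : ℝ} {ρ θ ρ' θ' : ℝ → T3 → ℝ} {u u' : ℝ → T3 → V3} {ζ : ℝ → ℝ} {J : Set ℝ} {a b : ℝ}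

/-- **The remainder is absorbed by the quadratic size of the difference** on compact time slabs:
for two classical solutions with densities valued in `[a, b] ⊆ J` (`ζ` smooth on the open set `J`),
the remainder `R` of `IsHardSphereEulerSolution.relativeEnergy_balance` satisfies `R ≤ C (α² + β² + |w|²)` on
`[0, t₁] × 𝕋³`, `t₁ < T` (every coefficient is a jointly smooth field, bounded on the slab;
`ζ` and `ζ + id·ζ'` are Lipschitz on `[a, b]`). [folklore] -/
theorem IsHardSphereEulerSolution.relativeEnergy_remainder_le
    (hE : IsHardSphereEulerSolution σ T ρ u θ)
    (hE' : IsHardSphereEulerSolution σ T ρ' u' θ') (hJ : IsOpen J) (hζ : ContDiffOn ℝ ∞ ζ J)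
    (hab : Icc a b ⊆ J) (hρab : ∀ t ∈ Ico 0 T, ∀ x, ρ t x ∈ Icc a b)
    (hρab' : ∀ t ∈ Ico 0 T, ∀ x, ρ' t x ∈ Icc a b) {t₁ : ℝ} (ht₁ : t₁ ∈ Ico 0 T) :
    ∃ C : ℝ, ∀ t ∈ Icc 0 t₁, ∀ x,
      -- α² and β²
      (1 / 2 * Torus.timeDerivWithin (Ico 0 T)
            (fun s y => θ s y * (ζ (ρ s y) + ρ s y * deriv ζ (ρ s y)) / ρ s y) t x -
          θ t x * (ζ (ρ t x) + ρ t x * deriv ζ (ρ t x)) / ρ t x *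
            ∑ i, Torus.partialDeriv i (fun y => u' t y i) x +
          1 / 2 * ∑ i, Torus.partialDeriv i
            (fun y => θ t y * (ζ (ρ t y) + ρ t y * deriv ζ (ρ t y)) / ρ t y * u t y i) x) *
        (ρ t x - ρ' t x) ^ 2 +
      (1 / 2 * Torus.timeDerivWithin (Ico 0 T) (fun s y => 3 / 2 * ρ s y / θ s y) t x -
          2 / 3 * (3 / 2 * ρ t x / θ t x) * ζ (ρ t x) *
            ∑ i, Torus.partialDeriv i (fun y => u' t y i) x +
          1 / 2 * ∑ i, Torus.partialDeriv i (fun y => 3 / 2 * ρ t y / θ t y * u t y i) x) *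
        (θ t x - θ' t x) ^ 2 +
      -- α wⱼ
      ∑ j, (-(θ t x * (ζ (ρ t x) + ρ t x * deriv ζ (ρ t x)) / ρ t x *
              Torus.partialDeriv j (ρ' t) x) -
            ∑ i, u' t x i * Torus.partialDeriv i (fun y => u' t y j) x -
            ζ (ρ t x) * Torus.partialDeriv j (θ' t) x -
            Torus.timeDerivWithin (Ico 0 T) (fun s y => u' s y j) t x +
            Torus.partialDeriv j (fun y => θ t y * (ζ (ρ t y) + ρ t y * deriv ζ (ρ t y))) x) *
          (ρ t x - ρ' t x) * (u t x j - u' t x j) +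
      -- wᵢ wⱼ
      ∑ i, ∑ j, -(ρ t x * Torus.partialDeriv i (fun y => u' t y j) x) *
          (u t x i - u' t x i) * (u t x j - u' t x j) +
      -- β wⱼ
      ∑ j, (-((ζ (ρ t x) + ρ t x * deriv ζ (ρ t x)) * Torus.partialDeriv j (ρ' t) x) -
            3 / 2 * ρ t x / θ t x * Torus.partialDeriv j (θ' t) x +
            Torus.partialDeriv j (fun y => ρ t y * ζ (ρ t y)) x) *
          (θ t x - θ' t x) * (u t x j - u' t x j) +
      -- (γ(ρ) - γ(ρ')) wⱼ and (ζ(ρ) - ζ(ρ')) wⱼ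
      ∑ j, -(θ' t x * Torus.partialDeriv j (ρ' t) x) *
          ((ζ (ρ t x) + ρ t x * deriv ζ (ρ t x)) - (ζ (ρ' t x) + ρ' t x * deriv ζ (ρ' t x))) *
          (u t x j - u' t x j) +
      ∑ j, -(ρ' t x * Torus.partialDeriv j (θ' t) x) * (ζ (ρ t x) - ζ (ρ' t x)) *
          (u t x j - u' t x j) +
      -- β (ζ(ρ) - ζ(ρ'))
      -(2 / 3 * (3 / 2 * ρ t x / θ t x) * θ' t x * ∑ i, Torus.partialDeriv i (fun y => u' t y i) x) *
        (θ t x - θ' t x) * (ζ (ρ t x) - ζ (ρ' t x)) ≤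
      C * ((ρ t x - ρ' t x) ^ 2 + (θ t x - θ' t x) ^ 2 + ‖u t x - u' t x‖ ^ 2) := by
  have hU : UniqueDiffOn ℝ (Ico (0 : ℝ) T) := uniqueDiffOn_Ico 0 T
  have hρJ : ∀ t ∈ Ico 0 T, ∀ x, ρ t x ∈ J := fun t ht x => hab (hρab t ht x)
  have hρJ' : ∀ t ∈ Ico 0 T, ∀ x, ρ' t x ∈ J := fun t ht x => hab (hρab' t ht x)
  -- the atoms: jointly smooth fields on `[0, T) × 𝕋³`
  have hρ := hE.smooth_density
  have hθ := hE.smooth_temperature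
  have hu := hE.smooth_velocity
  have hρ' := hE'.smooth_density
  have hθ' := hE'.smooth_temperature
  have hu' := hE'.smooth_velocity
  have hζρ := isSmoothSpaceTimeOn_comp_density hρ hζ hρJ
  have hζdρ := isSmoothSpaceTimeOn_comp_density hρ (hζ.deriv_of_isOpen (m := ∞) hJ le_rfl) hρJ
  have hAf := hE.isSmoothSpaceTimeOn_weightA hJ hζ hρJ
  have hBf := hE.isSmoothSpaceTimeOn_weightB
  have hγf : Torus.IsSmoothSpaceTimeOn (Ico 0 T)
      (fun s y => ζ (ρ s y) + ρ s y * deriv ζ (ρ s y)) := hζρ.add (hρ.mul hζdρ)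
  have hAt := hAf.timeDerivWithin hU
  have hBt := hBf.timeDerivWithin hU
  have hdU : ∀ i j, Torus.IsSmoothSpaceTimeOn (Ico 0 T)
      (fun t => Torus.partialDeriv i (fun y => u' t y j)) := fun i j => (hu'.apply j).partialDeriv hU i
  have hdR : ∀ j, Torus.IsSmoothSpaceTimeOn (Ico 0 T) (fun t => Torus.partialDeriv j (ρ' t)) :=
    fun j => hρ'.partialDeriv hU j
  have hdH : ∀ j, Torus.IsSmoothSpaceTimeOn (Ico 0 T) (fun t => Torus.partialDeriv j (θ' t)) :=
    fun j => hθ'.partialDeriv hU j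
  have hUt : ∀ j, Torus.IsSmoothSpaceTimeOn (Ico 0 T)
      (Torus.timeDerivWithin (Ico 0 T) (fun s y => u' s y j)) := fun j => (hu'.apply j).timeDerivWithin hU
  have hDAu : ∀ i, Torus.IsSmoothSpaceTimeOn (Ico 0 T) (fun t => Torus.partialDeriv i
      (fun y => θ t y * (ζ (ρ t y) + ρ t y * deriv ζ (ρ t y)) / ρ t y * u t y i)) :=
    fun i => (hAf.mul (hu.apply i)).partialDeriv hU i
  have hDBu : ∀ i, Torus.IsSmoothSpaceTimeOn (Ico 0 T) (fun t => Torus.partialDeriv i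
      (fun y => 3 / 2 * ρ t y / θ t y * u t y i)) := fun i => (hBf.mul (hu.apply i)).partialDeriv hU i
  have hDpr : ∀ j, Torus.IsSmoothSpaceTimeOn (Ico 0 T) (fun t => Torus.partialDeriv j
      (fun y => θ t y * (ζ (ρ t y) + ρ t y * deriv ζ (ρ t y)))) := fun j => (hθ.mul hγf).partialDeriv hU j
  have hDph : ∀ j, Torus.IsSmoothSpaceTimeOn (Ico 0 T) (fun t => Torus.partialDeriv j
      (fun y => ρ t y * ζ (ρ t y))) := fun j => (hρ.mul hζρ).partialDeriv hU j
  have hc : ∀ c : ℝ, Torus.IsSmoothSpaceTimeOn (Ico 0 T) (fun (_ : ℝ) (_ : T3) => c) := fun c =>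
    Torus.isSmoothSpaceTimeOn_const (Torus.isSmooth_const c) _
  have hSdU : Torus.IsSmoothSpaceTimeOn (Ico 0 T)
      (fun t x => ∑ i, Torus.partialDeriv i (fun y => u' t y i) x) :=
    Torus.IsSmoothSpaceTimeOn.sum fun i _ => hdU i i
  -- bounds of the eight coefficient families on `[0, t₁] × 𝕋³`
  obtain ⟨K1, hK1₀, hK1⟩ := exists_abs_le_of_isSmoothSpaceTimeOn
    ((((hc (1 / 2)).mul hAt).sub (hAf.mul hSdU)).add ((hc (1 / 2)).mul
      (Torus.IsSmoothSpaceTimeOn.sum fun i _ => hDAu i))) ht₁.2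
  obtain ⟨K2, hK2₀, hK2⟩ := exists_abs_le_of_isSmoothSpaceTimeOn
    ((((hc (1 / 2)).mul hBt).sub ((((hc (2 / 3)).mul hBf).mul hζρ).mul hSdU)).add ((hc (1 / 2)).mul
      (Torus.IsSmoothSpaceTimeOn.sum fun i _ => hDBu i))) ht₁.2
  obtain ⟨K3, hK3₀, hK3⟩ := exists_forall_abs_le_of_isSmoothSpaceTimeOn (fun j =>
    (((((hAf.mul (hdR j)).neg.sub (Torus.IsSmoothSpaceTimeOn.sum fun i _ =>
      (hu'.apply i).mul (hdU i j))).sub (hζρ.mul (hdH j))).sub (hUt j)).add (hDpr j))) ht₁.2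
  obtain ⟨K4, hK4₀, hK4⟩ := exists_forall_abs_le_of_isSmoothSpaceTimeOn
    (fun p : Fin 3 × Fin 3 => (hρ.mul (hdU p.1 p.2)).neg) ht₁.2
  obtain ⟨K5, hK5₀, hK5⟩ := exists_forall_abs_le_of_isSmoothSpaceTimeOn (fun j =>
    ((hγf.mul (hdR j)).neg.sub (hBf.mul (hdH j))).add (hDph j)) ht₁.2
  obtain ⟨K6, hK6₀, hK6⟩ := exists_forall_abs_le_of_isSmoothSpaceTimeOn (fun j =>
    (hθ'.mul (hdR j)).neg) ht₁.2
  obtain ⟨K7, hK7₀, hK7⟩ := exists_forall_abs_le_of_isSmoothSpaceTimeOn (fun j =>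
    (hρ'.mul (hdH j)).neg) ht₁.2
  obtain ⟨K8, hK8₀, hK8⟩ := exists_abs_le_of_isSmoothSpaceTimeOn
    ((((hc (2 / 3)).mul hBf).mul hθ').mul hSdU).neg ht₁.2
  -- Lipschitz constants of `ζ` and `ζ + id·ζ'` on `[a, b]`
  obtain ⟨Lz, -, hLz⟩ := exists_abs_sub_le_mul_of_contDiffOn hJ hζ hab
  obtain ⟨Lg, -, hLg⟩ := exists_abs_sub_le_mul_of_contDiffOn hJ
    (hζ.add (contDiffOn_id.mul (hζ.deriv_of_isOpen (m := ∞) hJ le_rfl))) hab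
  set K : ℝ := K1 + K2 + K3 + K4 + K5 + K6 + K7 + K8 with hK
  refine ⟨K * (10 + 3 * Lg ^ 2 + 4 * Lz ^ 2), fun t ht x => ?_⟩
  have htT : t ∈ Ico 0 T := ⟨ht.1, ht.2.trans_lt ht₁.2⟩
  have hnorm : ‖u t x - u' t x‖ ^ 2 = ∑ j, (u t x j - u' t x j) ^ 2 := by
    simp only [EuclideanSpace.norm_sq_eq, PiLp.sub_apply, Real.norm_eq_abs, sq_abs]
  rw [hnorm]
  apply remainder_alg_le
  · exact (hK1 t ht x).trans (by linarith)
  · exact (hK2 t ht x).trans (by linarith)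
  · exact fun j => (hK3 j t ht x).trans (by linarith)
  · exact fun i j => (hK4 (i, j) t ht x).trans (by linarith)
  · exact fun j => (hK5 j t ht x).trans (by linarith)
  · exact fun j => (hK6 j t ht x).trans (by linarith)
  · exact fun j => (hK7 j t ht x).trans (by linarith)
  · exact (hK8 t ht x).trans (by linarith)
  · exact hLz _ (hρab t htT x) _ (hρab' t htT x)
  · simpa only [id] using hLg _ (hρab t htT x) _ (hρab' t htT x)

/-- **Coercivity of the relative energy** on compact time slabs: `e ≥ m (α² + β² + |w|²)` on
`[0, t₁] × 𝕋³` with `m > 0` (the weights `A`, `ρ`, `B` are positive jointly smooth fields, hence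
bounded below on the slab; hyperbolicity `ζ + id·ζ' > 0` on `[a, b]` makes `A > 0`). [folklore] -/
theorem IsHardSphereEulerSolution.relativeEnergy_coercive
    (hE : IsHardSphereEulerSolution σ T ρ u θ) (hJ : IsOpen J)
    (hζ : ContDiffOn ℝ ∞ ζ J) (hab : Icc a b ⊆ J) (hγ : ∀ r ∈ Icc a b, 0 < ζ r + r * deriv ζ r)
    (hρab : ∀ t ∈ Ico 0 T, ∀ x, ρ t x ∈ Icc a b) (ρ' θ' : ℝ → T3 → ℝ) (u' : ℝ → T3 → V3)
    {t₁ : ℝ} (ht₁ : t₁ ∈ Ico 0 T) :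
    ∃ m : ℝ, 0 < m ∧ ∀ t ∈ Icc 0 t₁, ∀ x,
      m * ((ρ t x - ρ' t x) ^ 2 + (θ t x - θ' t x) ^ 2 + ‖u t x - u' t x‖ ^ 2) ≤
        1 / 2 * (θ t x * (ζ (ρ t x) + ρ t x * deriv ζ (ρ t x)) / ρ t x * (ρ t x - ρ' t x) ^ 2 +
          ρ t x * ‖u t x - u' t x‖ ^ 2 + 3 / 2 * ρ t x / θ t x * (θ t x - θ' t x) ^ 2) := by
  have hρJ : ∀ t ∈ Ico 0 T, ∀ x, ρ t x ∈ J := fun t ht x => hab (hρab t ht x)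
  have hAf := hE.isSmoothSpaceTimeOn_weightA hJ hζ hρJ
  have hBf := hE.isSmoothSpaceTimeOn_weightB
  have hApos : ∀ t ∈ Ico 0 T, ∀ x, 0 < θ t x * (ζ (ρ t x) + ρ t x * deriv ζ (ρ t x)) / ρ t x :=
    fun t ht x => div_pos (mul_pos (hE.temperature_pos t ht x) (hγ _ (hρab t ht x)))
      (hE.density_pos t ht x)
  have hBpos : ∀ t ∈ Ico 0 T, ∀ x, 0 < 3 / 2 * ρ t x / θ t x := fun t ht x =>
    div_pos (mul_pos (by norm_num) (hE.density_pos t ht x)) (hE.temperature_pos t ht x)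
  obtain ⟨a0, ha0, ha⟩ := exists_pos_le_of_isSmoothSpaceTimeOn hAf hApos ht₁.2
  obtain ⟨r0, hr0, hr⟩ := exists_pos_le_of_isSmoothSpaceTimeOn hE.smooth_density hE.density_pos ht₁.2
  obtain ⟨b0, hb0, hb⟩ := exists_pos_le_of_isSmoothSpaceTimeOn hBf hBpos ht₁.2
  refine ⟨min (min a0 r0) b0 / 2, by positivity, fun t ht x => ?_⟩
  exact energy_alg_ge (ha t ht x) (hr t ht x) (hb t ht x) (sq_nonneg _)

/-- **Uniqueness of classical hard-sphere Euler solutions with a smooth, hyperbolic equation of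
state** (Dafermos 2005, Thm 5.2.1, classical-vs-classical case, for the `5 × 5` system with
pressure `ρ θ ζ(ρ)` on `𝕋³`). Let `ζ` be smooth on an open set `J ⊇ [a, b]` with `ζ(r) + r ζ'(r) > 0` on `[a, b]`
(hyperbolicity: `∂p/∂ρ = θ (ζ + ρζ') > 0`). Two classical solutions of the hard-sphere Euler system
on `[0, T) × 𝕋³` whose pressure fields are `ρ θ ζ(ρ)` resp. `ρ' θ' ζ(ρ')` pointwise, whose
densities take values in `[a, b]`, and which have the same density, velocity and temperature at
`t = 0`, coincide on `[0, T)` (relative-energy method + Grönwall on `𝕋³`).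
[cite: Dafermos2005, Thm 5.2.1] -/
theorem IsHardSphereEulerSolution.unique_of_smooth_eos :
    ∀ {σ T : ℝ} {ρ θ ρ' θ' : ℝ → T3 → ℝ} {u u' : ℝ → T3 → V3} {ζ : ℝ → ℝ} {J : Set ℝ} {a b : ℝ},
      IsHardSphereEulerSolution σ T ρ u θ → IsHardSphereEulerSolution σ T ρ' u' θ' → IsOpen J →
      ContDiffOn ℝ (⊤ : ℕ∞) ζ J → Icc a b ⊆ J → (∀ r ∈ Icc a b, 0 < ζ r + r * deriv ζ r) →
      (∀ t ∈ Ico 0 T, ∀ x, ρ t x ∈ Icc a b) → (∀ t ∈ Ico 0 T, ∀ x, ρ' t x ∈ Icc a b) →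
      (∀ t ∈ Ico 0 T, ∀ x, hsPressure σ (ρ t x) (θ t x) = ρ t x * θ t x * ζ (ρ t x)) →
      (∀ t ∈ Ico 0 T, ∀ x, hsPressure σ (ρ' t x) (θ' t x) = ρ' t x * θ' t x * ζ (ρ' t x)) →
      ρ 0 = ρ' 0 → u 0 = u' 0 → θ 0 = θ' 0 →
      ∀ t ∈ Ico 0 T, ρ t = ρ' t ∧ u t = u' t ∧ θ t = θ' t := by
  intro σ T ρ θ ρ' θ' u u' ζ J a b hE hE' hJ hζ hab hγ hρab hρab' hp hp' h0 hu0 hθ0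
  have hρJ : ∀ t ∈ Ico 0 T, ∀ x, ρ t x ∈ J := fun t ht x => hab (hρab t ht x)
  have hρJ' : ∀ t ∈ Ico 0 T, ∀ x, ρ' t x ∈ J := fun t ht x => hab (hρab' t ht x)
  have hρ := hE.smooth_density
  have hθ := hE.smooth_temperature
  have hu := hE.smooth_velocity
  have hρ' := hE'.smooth_density
  have hθ' := hE'.smooth_temperature
  have hu' := hE'.smooth_velocity
  have hζρ := isSmoothSpaceTimeOn_comp_density hρ hζ hρJ
  have hζdρ := isSmoothSpaceTimeOn_comp_density hρ (hζ.deriv_of_isOpen (m := ∞) hJ le_rfl) hρJ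
  have hAf := hE.isSmoothSpaceTimeOn_weightA hJ hζ hρJ
  have hBf := hE.isSmoothSpaceTimeOn_weightB
  have hγf : Torus.IsSmoothSpaceTimeOn (Ico 0 T)
      (fun s y => ζ (ρ s y) + ρ s y * deriv ζ (ρ s y)) := hζρ.add (hρ.mul hζdρ)
  -- the energy density and the fluxes are jointly smooth
  have hal2 : Torus.IsSmoothSpaceTimeOn (Ico 0 T) (fun t x => (ρ t x - ρ' t x) ^ 2) :=
    (hρ.sub hρ').pow 2
  have hbe2 : Torus.IsSmoothSpaceTimeOn (Ico 0 T) (fun t x => (θ t x - θ' t x) ^ 2) :=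
    (hθ.sub hθ').pow 2
  have hw2 : Torus.IsSmoothSpaceTimeOn (Ico 0 T) (fun t x => ‖u t x - u' t x‖ ^ 2) :=
    (hu.sub hu').norm_sq ℝ
  have hhalf : Torus.IsSmoothSpaceTimeOn (Ico 0 T) (fun (_ : ℝ) (_ : T3) => (1 / 2 : ℝ)) :=
    Torus.isSmoothSpaceTimeOn_const (Torus.isSmooth_const _) _
  have he : Torus.IsSmoothSpaceTimeOn (Ico 0 T) (fun s y => 1 / 2 *
      (θ s y * (ζ (ρ s y) + ρ s y * deriv ζ (ρ s y)) / ρ s y * (ρ s y - ρ' s y) ^ 2 +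
        ρ s y * ‖u s y - u' s y‖ ^ 2 + 3 / 2 * ρ s y / θ s y * (θ s y - θ' s y) ^ 2)) :=
    hhalf.mul (((hAf.mul hal2).add (hρ.mul hw2)).add (hBf.mul hbe2))
  have hΦ : ∀ i, Torus.IsSmoothSpaceTimeOn (Ico 0 T) (fun t y =>
      1 / 2 * (θ t y * (ζ (ρ t y) + ρ t y * deriv ζ (ρ t y)) / ρ t y * u t y i *
            (ρ t y - ρ' t y) ^ 2 +
          ρ t y * u t y i * ‖u t y - u' t y‖ ^ 2 +
          3 / 2 * ρ t y / θ t y * u t y i * (θ t y - θ' t y) ^ 2) +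
        θ t y * (ζ (ρ t y) + ρ t y * deriv ζ (ρ t y)) * (ρ t y - ρ' t y) * (u t y i - u' t y i) +
        ρ t y * ζ (ρ t y) * (θ t y - θ' t y) * (u t y i - u' t y i)) := fun i =>
    ((hhalf.mul ((((hAf.mul (hu.apply i)).mul hal2).add ((hρ.mul (hu.apply i)).mul hw2)).add
      ((hBf.mul (hu.apply i)).mul hbe2))).add
      (((hθ.mul hγf).mul (hρ.sub hρ')).mul ((hu.apply i).sub (hu'.apply i)))).add
      (((hρ.mul hζρ).mul (hθ.sub hθ')).mul ((hu.apply i).sub (hu'.apply i)))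
  have hApos : ∀ t ∈ Ico 0 T, ∀ x, 0 < θ t x * (ζ (ρ t x) + ρ t x * deriv ζ (ρ t x)) / ρ t x :=
    fun t ht x => div_pos (mul_pos (hE.temperature_pos t ht x) (hγ _ (hρab t ht x)))
      (hE.density_pos t ht x)
  have hBpos : ∀ t ∈ Ico 0 T, ∀ x, 0 < 3 / 2 * ρ t x / θ t x := fun t ht x =>
    div_pos (mul_pos (by norm_num) (hE.density_pos t ht x)) (hE.temperature_pos t ht x)
  have hzero := torus_energy_eq_zero_of_balance (Φ := fun i t y =>
      1 / 2 * (θ t y * (ζ (ρ t y) + ρ t y * deriv ζ (ρ t y)) / ρ t y * u t y i *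
            (ρ t y - ρ' t y) ^ 2 +
          ρ t y * u t y i * ‖u t y - u' t y‖ ^ 2 +
          3 / 2 * ρ t y / θ t y * u t y i * (θ t y - θ' t y) ^ 2) +
        θ t y * (ζ (ρ t y) + ρ t y * deriv ζ (ρ t y)) * (ρ t y - ρ' t y) * (u t y i - u' t y i) +
        ρ t y * ζ (ρ t y) * (θ t y - θ' t y) * (u t y i - u' t y i)) he hΦ
    (fun t ht x => ?_) (fun x => ?_) (fun t₁ ht₁ => ?_)
  · -- conclusion: the energy density vanishes, hence so do `α`, `w`, `β`
    intro t ht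
    have hpt : ∀ x, ρ t x - ρ' t x = 0 ∧ u t x - u' t x = 0 ∧ θ t x - θ' t x = 0 := fun x =>
      eq_of_energy_eq_zero (hApos t ht x) (hE.density_pos t ht x) (hBpos t ht x) (hzero t ht x)
    exact ⟨funext fun x => sub_eq_zero.1 (hpt x).1, funext fun x => sub_eq_zero.1 (hpt x).2.1,
      funext fun x => sub_eq_zero.1 (hpt x).2.2⟩
  · -- `e ≥ 0`
    exact mul_nonneg (by norm_num) (add_nonneg (add_nonneg
      (mul_nonneg (hApos t ht x).le (sq_nonneg _))
      (mul_nonneg (hE.density_pos t ht x).le (sq_nonneg _)))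
      (mul_nonneg (hBpos t ht x).le (sq_nonneg _)))
  · -- `e(0, ·) = 0`
    rw [show ρ 0 x = ρ' 0 x from congrFun h0 x, show u 0 x = u' 0 x from congrFun hu0 x,
      show θ 0 x = θ' 0 x from congrFun hθ0 x]
    simp
  · -- the balance `∂ₜe + Σᵢ∂ᵢΦᵢ = R ≤ C e` on `[0, t₁] × 𝕋³`
    obtain ⟨C, hC⟩ := hE.relativeEnergy_remainder_le hE' hJ hζ hab hρab hρab' ht₁
    obtain ⟨m, hm0, hm⟩ := hE.relativeEnergy_coercive hJ hζ hab hγ hρab ρ' θ' u' ht₁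
    refine ⟨max C 0 / m, fun t ht x => ?_⟩
    have htT : t ∈ Ico 0 T := ⟨ht.1, ht.2.trans_lt ht₁.2⟩
    exact (hE.relativeEnergy_balance hE' hJ hζ hρJ hρJ' hp hp' htT x).trans_le
      (le_max_div_mul_of_le (hC t ht x) (hm t ht x) (by positivity) hm0)

end Solutions

/-- **Uniqueness of classical hard-sphere Euler solutions at small packing** (Dafermos 2005,
Thm 5.2.1, for this system; literally hypothesis (3) `huniq` of
`hsEuler_continuousDependence_of_localTheory`). If the hard-sphere excess free energy agrees on
`[0, η₀)` with a function `F` analytic on `(-η₀, η₀)`, there is `η₁ > 0` such that for every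
reduced diameter `σ > 0` and every horizon `T`, two classical solutions `(ρ, u, θ)`,
`(ρ', u', θ')` of the hard-sphere Euler system on `[0, T) × 𝕋³` with packing fractions
`ρσ³, ρ'σ³ ≤ η₁` and equal density, velocity and temperature at `t = 0` coincide on `[0, T)`:
the system is symmetrisable hyperbolic at small packing (`Z(η) + ηZ'(η) → 1` as `η → 0`,
`Z = 1 + ηF'` on `(0, η₀)` by `hsCompressibility_eq`), and the relative-energy method with
Grönwall's lemma on `𝕋³` applies (`IsHardSphereEulerSolution.unique_of_smooth_eos` with
`ζ(r) = Z(rσ³)`). [cite: Dafermos2005, Thm 5.2.1] -/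
theorem hsEuler_uniqueness_smallPacking :
    ∀ η₀ : ℝ, 0 < η₀ → ∀ F : ℝ → ℝ, AnalyticOnNhd ℝ F (Ioo (-η₀) η₀) →
      EqOn hsExcessFreeEnergy F (Ico 0 η₀) →
      ∃ η₁ : ℝ, 0 < η₁ ∧ ∀ σ : ℝ, 0 < σ →
        ∀ (T : ℝ) (ρ θ : ℝ → T3 → ℝ) (u : ℝ → T3 → V3) (ρ' θ' : ℝ → T3 → ℝ) (u' : ℝ → T3 → V3),
          IsHardSphereEulerSolution σ T ρ u θ → IsHardSphereEulerSolution σ T ρ' u' θ' →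
          (∀ t ∈ Ico 0 T, ∀ x, ρ t x * σ ^ 3 ≤ η₁) → (∀ t ∈ Ico 0 T, ∀ x, ρ' t x * σ ^ 3 ≤ η₁) →
          ρ 0 = ρ' 0 → u 0 = u' 0 → θ 0 = θ' 0 →
          ∀ t ∈ Ico 0 T, ρ t = ρ' t ∧ u t = u' t ∧ θ t = θ' t := by
  intro η₀ hη₀ F hF hEq
  obtain ⟨Zf, hZf⟩ : ∃ Zf : ℝ → ℝ, Zf = fun η => 1 + η * deriv F η := ⟨_, rfl⟩
  have hFc : ContDiffOn ℝ ∞ F (Ioo (-η₀) η₀) := hF.contDiffOn_of_completeSpace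
  have hZc : ContDiffOn ℝ ∞ Zf (Ioo (-η₀) η₀) := by
    rw [hZf]
    exact contDiffOn_const.add (contDiffOn_id.mul (hFc.deriv_of_isOpen (m := ∞) isOpen_Ioo le_rfl))
  have hZd : ContDiffOn ℝ ∞ (deriv Zf) (Ioo (-η₀) η₀) := hZc.deriv_of_isOpen isOpen_Ioo le_rfl
  have h0mem : (0 : ℝ) ∈ Ioo (-η₀) η₀ := ⟨by linarith, hη₀⟩
  -- hyperbolicity near packing `0`: `Z + ηZ'` is continuous at `0` with value `1`
  have hgc : ContinuousAt (fun η => Zf η + η * deriv Zf η) 0 :=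
    (hZc.continuousOn.continuousAt (isOpen_Ioo.mem_nhds h0mem)).add
      (continuousAt_id.mul (hZd.continuousOn.continuousAt (isOpen_Ioo.mem_nhds h0mem)))
  have hg0 : Zf 0 + 0 * deriv Zf 0 = 1 := by simp [hZf]
  have hev : ∀ᶠ η in 𝓝 (0 : ℝ), 1 / 2 < Zf η + η * deriv Zf η := by
    have h : (fun η => Zf η + η * deriv Zf η) ⁻¹' Ioi (1 / 2) ∈ 𝓝 (0 : ℝ) := by
      refine hgc.preimage_mem_nhds ?_
      show Ioi (1 / 2 : ℝ) ∈ 𝓝 (Zf 0 + 0 * deriv Zf 0)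
      rw [hg0]
      exact Ioi_mem_nhds (by norm_num)
    exact h
  obtain ⟨δ, hδ, hδg⟩ := Metric.eventually_nhds_iff.1 hev
  refine ⟨min (η₀ / 2) (δ / 2), by positivity, ?_⟩
  intro σ hσ T ρ θ u ρ' θ' u' hE hE' hpk hpk' h0 hu0 hθ0
  have hσ3 : 0 < σ ^ 3 := pow_pos hσ 3
  have hη₁η₀ : min (η₀ / 2) (δ / 2) < η₀ := (min_le_left _ _).trans_lt (by linarith)
  have hη₁δ : min (η₀ / 2) (δ / 2) < δ := (min_le_right _ _).trans_lt (by linarith)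
  -- the rescaled law `ζ(r) = Z(rσ³)` on `J = {r | rσ³ ∈ (-η₀, η₀)}`
  have hJo : IsOpen ((fun r : ℝ => r * σ ^ 3) ⁻¹' Ioo (-η₀) η₀) :=
    isOpen_Ioo.preimage (continuous_id.mul continuous_const)
  have hζ : ContDiffOn ℝ ∞ (fun r => Zf (r * σ ^ 3)) ((fun r : ℝ => r * σ ^ 3) ⁻¹' Ioo (-η₀) η₀) :=
    hZc.comp (contDiffOn_id.mul contDiffOn_const) fun r hr => hr
  have hab : Icc 0 (min (η₀ / 2) (δ / 2) / σ ^ 3) ⊆ (fun r : ℝ => r * σ ^ 3) ⁻¹' Ioo (-η₀) η₀ := by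
    intro r hr
    have h1 : 0 ≤ r * σ ^ 3 := mul_nonneg hr.1 hσ3.le
    have h2 : r * σ ^ 3 ≤ min (η₀ / 2) (δ / 2) := (le_div_iff₀ hσ3).1 hr.2
    exact ⟨by linarith, by linarith⟩
  have hγ : ∀ r ∈ Icc 0 (min (η₀ / 2) (δ / 2) / σ ^ 3),
      0 < (fun r => Zf (r * σ ^ 3)) r + r * deriv (fun r => Zf (r * σ ^ 3)) r := by
    intro r hr
    have h1 : 0 ≤ r * σ ^ 3 := mul_nonneg hr.1 hσ3.le
    have h2 : r * σ ^ 3 ≤ min (η₀ / 2) (δ / 2) := (le_div_iff₀ hσ3).1 hr.2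
    have hmem : r * σ ^ 3 ∈ Ioo (-η₀) η₀ := hab hr
    have hd : HasDerivAt (fun r => Zf (r * σ ^ 3)) (deriv Zf (r * σ ^ 3) * σ ^ 3) r := by
      have hz : HasDerivAt Zf (deriv Zf (r * σ ^ 3)) (r * σ ^ 3) :=
        ((hZc.differentiableOn (by simp)).differentiableAt (isOpen_Ioo.mem_nhds hmem)).hasDerivAt
      have hl : HasDerivAt (fun r : ℝ => r * σ ^ 3) (σ ^ 3) r := by
        simpa using (hasDerivAt_id r).mul_const (σ ^ 3)
      exact hz.comp r hl
    have hlt : 1 / 2 < Zf (r * σ ^ 3) + r * σ ^ 3 * deriv Zf (r * σ ^ 3) := by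
      refine hδg ?_
      rw [dist_zero_right, Real.norm_eq_abs, abs_of_nonneg h1]
      linarith
    show 0 < Zf (r * σ ^ 3) + r * deriv (fun r => Zf (r * σ ^ 3)) r
    rw [hd.deriv]
    nlinarith
  -- the pressure fields and the density ranges of the two solutions
  have hp : ∀ t ∈ Ico 0 T, ∀ x,
      hsPressure σ (ρ t x) (θ t x) = ρ t x * θ t x * (fun r => Zf (r * σ ^ 3)) (ρ t x) := by
    intro t ht x
    have hη : ρ t x * σ ^ 3 ∈ Ioo 0 η₀ :=
      ⟨mul_pos (hE.density_pos t ht x) hσ3, (hpk t ht x).trans_lt hη₁η₀⟩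
    show ρ t x * θ t x * hsCompressibility (ρ t x * σ ^ 3) = ρ t x * θ t x * Zf (ρ t x * σ ^ 3)
    rw [hsCompressibility_eq hEq hη, hZf]
  have hp' : ∀ t ∈ Ico 0 T, ∀ x,
      hsPressure σ (ρ' t x) (θ' t x) = ρ' t x * θ' t x * (fun r => Zf (r * σ ^ 3)) (ρ' t x) := by
    intro t ht x
    have hη : ρ' t x * σ ^ 3 ∈ Ioo 0 η₀ :=
      ⟨mul_pos (hE'.density_pos t ht x) hσ3, (hpk' t ht x).trans_lt hη₁η₀⟩
    show ρ' t x * θ' t x * hsCompressibility (ρ' t x * σ ^ 3) = ρ' t x * θ' t x * Zf (ρ' t x * σ ^ 3)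
    rw [hsCompressibility_eq hEq hη, hZf]
  have hρab : ∀ t ∈ Ico 0 T, ∀ x, ρ t x ∈ Icc 0 (min (η₀ / 2) (δ / 2) / σ ^ 3) := fun t ht x =>
    ⟨(hE.density_pos t ht x).le, (le_div_iff₀ hσ3).2 (hpk t ht x)⟩
  have hρab' : ∀ t ∈ Ico 0 T, ∀ x, ρ' t x ∈ Icc 0 (min (η₀ / 2) (δ / 2) / σ ^ 3) := fun t ht x =>
    ⟨(hE'.density_pos t ht x).le, (le_div_iff₀ hσ3).2 (hpk' t ht x)⟩
  exact hE.unique_of_smooth_eos hE' hJo hζ hab hγ hρab hρab' hp hp' h0 hu0 hθ0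


end Literature.MathematicalPhysics.KineticTheory

end
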